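import Summits.AtomisticToContinuum.HydrodynamicLimit.Theses.InformationPercolationEngine
import Summits.AtomisticToContinuum.HydrodynamicLimit.Theorems.JParityClosureCollisionTightnessDomination
import HarnessLib

/-!
# `InformationPercolationEngine.CollisionMomentBound` (stmt-AtomisticToContinuum-15144): the reduction
# to exponential upper tails of the collision functional AT EQUILIBRIUM

Helper file (`--supports stmt-AtomisticToContinuum-15144`).  The support item `CollisionMomentBound` asks
for tightness, uniformly in `N`, of the velocity-weighted empirical collision functional
`K_N[1 + ‖vᵢ‖² + ‖vⱼ‖²] = ε_N (N+1)⁻¹ Σ_{collision times s ≤ τ} Σ_{ordered contact pairs (i,j)} (1 + ‖vᵢ(s)‖² + ‖vⱼ(s)‖²)`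
under the LOCAL Gibbs laws `P_N = localGibbsLaw σ a₀ u₀ θ₀ N Φ_N` with continuous profiles.  The
planned proof (route text, "Expected proof (i)–(iii)") moves an EQUILIBRIUM estimate to local Gibbs
data by the entropy inequality; this file isolates exactly what that transfer needs and proves the
transfer:

* `collisionMomentBound_of_equilibrium_exp_tails` — IF for every reference temperature `θ₁ > 0`, all
  small `σ`, every flow family, every `τ > 0` and EVERY rate `c` there are `K, N₀` with
  `G_N{K < K_N[1 + ‖v‖² + ‖w‖²]} ≤ exp(−c (N+1))` for `N ≥ N₀` under the homogeneous (flow-invariant)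
  Gibbs laws `G_N = localGibbsLaw σ 1 0 θ₁ N Φ_N`, THEN `CollisionMomentBound` holds.  Proof: the
  domination `localGibbsMeasure σ a₀ u₀ θ₀ N ≤ Λ^{N+1} • localGibbsMeasure σ 1 0 θ₁ N`
  (`exists_localGibbsMeasure_le_smul_const`, `θ₁ = 2 sup θ₀`; the measure form of
  `H(P_N | G_N) = O(N)`) turns the rate-`c` tail into `Λ^{N+1} e^{−c(N+1)} = e^{−(N+1)} ≤ δ` for
  `c = log Λ + 1` and `N` large.

What is NOT proved, and why.  The hypothesis is a speed-`N` large-deviation UPPER bound for a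
superextensive (`≍ N^{4/3}` terms) collision functional of the deterministic hard-sphere gas in
equilibrium at fixed reduced density — not in print (the flux/Markov bound of the companion file
`…CollisionMomentBoundRung0` gives only `O(1/K)` tails), and the exponential loss `Λ^{N+1}` of any
global comparison of a non-constant local Gibbs law with an invariant law cannot be avoided (relative
entropy of order `N`).  It is recorded here as the precise statement the entropy route needs, not as a
claim; the weaker collision-COUNT version is the hypothesis `hEq` of
`collisionTightness_of_equilibrium_exp_tails` (item stmt-AtomisticToContinuum-13085, same status).

References: H. Spohn, *Large Scale Dynamics of Interacting Particles* (1991), Part I §2.3–§3;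
C. Kipnis, C. Landim, *Scaling Limits of Interacting Particle Systems* (1999), App. 1 Prop. 8.2.
-/

noncomputable section

open MeasureTheory Set Filter Topology
open scoped ENNReal

namespace Summit.AtomisticToContinuum.HydrodynamicLimit.Theorems.CollisionMomentBound

open Literature.Analysis.FluidPDE Literature.MathematicalPhysics.KineticTheory

/-- **`CollisionMomentBound` follows from exponential upper tails at equilibrium.** IF, for every
temperature `θ₁ > 0`, all small `σ`, every family of hard-sphere flows, every horizon `τ > 0` and EVERY
rate `c`, the velocity-weighted collision functional `K_N[1 + ‖vᵢ‖² + ‖vⱼ‖²]` (the `Kc` of the route decl)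
has upper tails `G_N{K < K_N} ≤ exp(−c (N+1))` for `N ≥ N₀(c)` under the homogeneous (flow-invariant)
Gibbs laws `G_N = localGibbsLaw σ 1 0 θ₁ N Φ_N`, THEN
`InformationPercolationEngine.CollisionMomentBound` (the tightness of the same functional under every
continuous local Gibbs law) holds: by `exists_localGibbsMeasure_le_smul_const` the local Gibbs
probability of the tail event is at most `Λ^{N+1} exp(−c(N+1)) = exp(−(N+1)) ≤ δ` for `c = log Λ + 1`.
The hypothesis is a speed-`N` large-deviation upper bound for the collision functional of the
deterministic hard-sphere gas in equilibrium; it is OPEN. [folklore] -/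
theorem collisionMomentBound_of_equilibrium_exp_tails
    (hEq : ∀ θ₁ : ℝ, 0 < θ₁ → ∃ σ₀ : ℝ, 0 < σ₀ ∧ ∀ σ : ℝ, 0 < σ → σ < σ₀ →
      ∀ Φ : (N : ℕ) → HardSphereFlow (Torus.geometry (Fin 3)) (hsDiameter σ N) (N + 1),
      ∀ τ : ℝ, 0 < τ → ∀ c : ℝ, ∃ K : ℝ, ∃ N₀ : ℕ, ∀ N : ℕ, N₀ ≤ N →
        let ε := hsDiameter σ N
        let G : Geometry (Fin 3) T3 := Torus.geometry (Fin 3)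
        let γ : Config (N + 1) (Fin 3) T3 → ℝ → Config (N + 1) (Fin 3) T3 := fun z s => (Φ N).flow s z
        let Kc : (Config (N + 1) (Fin 3) T3 → ℝ → Fin (N + 1) → Fin (N + 1) → ℝ) →
            Config (N + 1) (Fin 3) T3 → ℝ := fun F z => ε / (N + 1 : ℝ) *
          ∑ᶠ (s : ℝ) (_ : s ∈ collisionTimes G ε (γ z) ∩ Set.Icc 0 τ),
            ∑ i : Fin (N + 1), ∑ j : Fin (N + 1),
              (if i ≠ j ∧ ‖G.sepVec (γ z s i).1 (γ z s j).1‖ = ε then F z s i j else 0)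
        localGibbsLaw σ (fun _ => 1) (fun _ => (0 : V3)) (fun _ => θ₁) N (Φ N)
            {z | K < Kc (fun z s i j => 1 + ‖(γ z s i).2‖ ^ 2 + ‖(γ z s j).2‖ ^ 2) z} ≤
          ENNReal.ofReal (Real.exp (-c * (N + 1)))) :
    _root_.Summit.AtomisticToContinuum.HydrodynamicLimit.Theses.InformationPercolationEngine.CollisionMomentBound := by
  unfold Summit.AtomisticToContinuum.HydrodynamicLimit.Theses.InformationPercolationEngine.CollisionMomentBound
  intro a₀ θ₀ u₀ ha hθ hu ha0 hθ0
  obtain ⟨θ₁, hθ₁, Λ, hΛ, hdom⟩ := exists_localGibbsMeasure_le_smul_const ha hθ hu ha0 hθ0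
  obtain ⟨σ₀, hσ₀, H⟩ := hEq θ₁ hθ₁
  refine ⟨min σ₀ (1 / 2), lt_min hσ₀ (by norm_num), fun σ hσ hσlt Φ τ hτ δ hδ => ?_⟩
  have hσ₀' : σ < σ₀ := hσlt.trans_le (min_le_left _ _)
  have hσ2 : σ ≤ 1 / 2 := (hσlt.trans_le (min_le_right _ _)).le
  have hΛ0 : 0 < Λ := one_pos.trans_le hΛ
  set c : ℝ := Real.log Λ + 1 with hc
  obtain ⟨K, N₀, hK⟩ := H σ hσ hσ₀' Φ τ hτ c
  obtain ⟨N₁, hN₁⟩ := exists_exp_neg_succ_le hδ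
  refine ⟨K, max N₀ N₁, fun N hN => ?_⟩
  have hN0 : N₀ ≤ N := (le_max_left _ _).trans hN
  have hN1 : N₁ ≤ N := (le_max_right _ _).trans hN
  have hΛc : Λ * Real.exp (-c) = Real.exp (-1) := by
    rw [hc, neg_add, Real.exp_add, Real.exp_neg (Real.log Λ), Real.exp_log hΛ0]
    field_simp
  have hprod : Λ ^ (N + 1) * Real.exp (-c * ((N : ℝ) + 1)) = Real.exp (-((N : ℝ) + 1)) := by
    rw [show -c * ((N : ℝ) + 1) = ((N + 1 : ℕ) : ℝ) * (-c) by push_cast; ring,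
      Real.exp_nat_mul, ← mul_pow, hΛc, ← Real.exp_nat_mul]
    congr 1
    push_cast
    ring
  have hK' := hK N hN0
  simp only [] at hK' ⊢
  rw [localGibbsLaw_eq] at hK' ⊢
  refine (Measure.le_iff'.1 (hdom σ hσ2 N) _).trans ?_
  rw [Measure.smul_apply, smul_eq_mul]
  calc ENNReal.ofReal (Λ ^ (N + 1)) * _
      ≤ ENNReal.ofReal (Λ ^ (N + 1)) * ENNReal.ofReal (Real.exp (-c * (N + 1))) := by
        gcongr
    _ = ENNReal.ofReal (Λ ^ (N + 1) * Real.exp (-c * ((N : ℝ) + 1))) :=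
        (ENNReal.ofReal_mul (by positivity)).symm
    _ ≤ ENNReal.ofReal δ := ENNReal.ofReal_le_ofReal (hprod ▸ hN₁ N hN1)

end Summit.AtomisticToContinuum.HydrodynamicLimit.Theorems.CollisionMomentBound

end
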